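import Mathlib
import HarnessLib
import Summits.HubbardSuperconductivity.HubbardSuperconductivity.Theorems.KLProgrammeKLRegimeEngineScaleZeroV17FG7
import Summits.HubbardSuperconductivity.HubbardSuperconductivity.Theorems.KLProgrammeKLRegimeEngineV8DefsU9

/-!
# Stub (a) `stub_engine_scale0` of the K3 ENGINE-FLOW child under token #10 FINAL (`klEngU₀6 ↦ klEngU₀9`, plan g17 (R41d))

Cell `gate-hubbard-kl`, seat hubbard-kl-k3c2-p1 g4.  The (E3-THR) door `klEngU₀9 P R c := min (klEngU₀8 P R c) (R.cz * klEngU₀4 P R c)` (p1b g8,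
`…EngineV8DefsU9`) re-keys the `U₀` binder of every stub of the 20437 render; stub (a) is monotone in that binder, so its closer at
`klEngU₀6` (`stub_engine_scale0_klEng7`, `…ScaleZeroV17FG7`, p530960) yields the `klEngU₀9` instance by `klEngU₀9_le_klEngU₀6`:

* **`stub_engine_scale0_klEng7U9`** — LITERALLY the registered text of stub (a) with tokens #7 (`klEngGeo7`) and #10 (`klEngU₀9`), UNCONDITIONAL.

Bookkeeping only; nothing about the model is asserted beyond the cited upstream theorems; nothing asserts superconductivity.
-/

noncomputable section

namespace Summit.HubbardSuperconductivity.HubbardSuperconductivity.Theorems.EngineV8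

set_option linter.dupNamespace false -- summit = problem name (single-conjunct summit), D-0017

open Real Finset Literature.MathematicalPhysics.QuantumLattice Literature.Probability.LatticeModels
open Summit.HubbardSuperconductivity.HubbardSuperconductivity.Theorems.KLRegimeSplit
open Summit.HubbardSuperconductivity.HubbardSuperconductivity.Theorems.KLProgrammeLegKernels

/-- **STUB (a) `stub_engine_scale0` OF THE ENGINE-FLOW SKELETON AT (klEngGeo7, klEngQ6, klEngC₃6, klEngU₀9) — PROVED.**  For every `P R c`
with `P.WF`, `R.WF2`, `0 < c ≤ klEngC₃6 P R`, `μ ∈ klWindowC`, `0 < U ≤ klEngU₀9 P R c`, `klBetaMin ≤ β ≤ e^{c/U²}`, volumes above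
`klEngL₃ / klEngM₃`, and the bare flow frame `K₀ = klFlowFrameU L M β U μ 0` admissible: (E1-v4)₀ ∧ (E2-F2)₀ ∧ (E2′-F UV)₀ ∧ (E4)₀ ∧ (E5-F)₀
at `(klEngGeo7, klEngQ6 P R)` — `stub_engine_scale0_klEng7` through `klEngU₀9_le_klEngU₀6`. -/
theorem stub_engine_scale0_klEng7U9 :
    ∀ (P : SplitConsts) (R : RenConsts) (c : ℝ), P.WF → R.WF2 → 0 < c → c ≤ klEngC₃6 P R →
      ∀ μ ∈ klWindowC, ∀ U : ℝ, 0 < U → U ≤ klEngU₀9 P R c → ∀ β : ℝ, klBetaMin ≤ β → β ≤ Real.exp (c / U ^ 2) →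
        ∀ (L M : ℕ) [NeZero L] [NeZero M], klEngL₃ β U ≤ L → klEngM₃ β U L ≤ M →
          FrameOK R U (nScales β) μ (klFlowFrameU L M β U μ 0) →
            KernelNormsV4 L M P (klEngQ6 P R) β U μ (klFlowFrameU L M β U μ 0) 0 ∧
              PairLadderStepAtV17F2 L M klEngGeo7 P (klEngQ6 P R) β U μ 0 ∧
                QuarticValueUVAtV17F L M klEngGeo7 P (klEngQ6 P R) β U μ 0 ∧
                  EngineFirstMoments L M klEngGeo7 P (klEngQ6 P R) β U μ (klFlowFrameU L M β U μ 0) 0 ∧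
                    IsoTupleL1AtV17F L M klEngGeo7 P β U μ 0 :=
  fun P R c hP hR hc hc₆ μ hμ U hU hU₀ β hβ hβc L M _ _ hL hM hK =>
    stub_engine_scale0_klEng7 P R c hP hR hc hc₆ μ hμ U hU (hU₀.trans (klEngU₀9_le_klEngU₀6 P R c)) β hβ hβc L M hL hM hK

end Summit.HubbardSuperconductivity.HubbardSuperconductivity.Theorems.EngineV8

end
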